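import Summits.AtomisticToContinuum.BoseEinsteinCondensation.Theorems.BECSwapNoCatastropheDefs
import HarnessLib

/-!
# Crux `TorusHalfSwapOverlap` (stmt-AtomisticToContinuum-14393), line `birth`, stub `stub_twoCopyIMS` (S7i)

Route `BECSwapNoCatastrophe` (sub-problem `BoseEinsteinCondensation`), lead c6 (2026-08-17). THE TWO-COPY IMS
LOCALISATION FORMULA WITH THE BOSONIC FLOOR (engine of the hard-core upper frame S7, replacing the ground-state
eigen-equation): for a `C¹` two-copy function `Θ` on `(ℝ³)^{n+1} × (ℝ³)^{n+1}`, periodic in every particle of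
either copy, and a `C¹` periodic quadratic partition of unity `J₁² + J₂² = 1` (real),

  `E2(0)(Θ J₁) + 2 E₀^per(n+1, L) · ‖Θ J₂‖² ≤ E2(0)(Θ) + ∫_{cell²} |Θ|² (|∇J₁|² + |∇J₂|²)`

in the folded `TwoCopyTorus` vocabulary of `Theorems/BECSwapNoCatastropheDefs.lean` (the gradient squares of the
real `J`'s are written as `kinetic2` of the `J`'s read in `ℂ`).

Proof. (1) POINTWISE IMS, one coordinate direction at a time: with `a = ∂Θ`, `w = Θ Z` (complex) and
`α = J₁ Z`, `β = ∂J₁`, `γ = J₂ Z`, `δ = ∂J₂` (real), the product rule gives `∂(Θ Jᵢ) = w ∂Jᵢ + Jᵢ a`, and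
`|w β + α a|² + |w δ + γ a|² = |a|² + |w|² (β² + δ²)` because `α² + γ² = 1` and `α β + γ δ = ½ ∂(J₁² + J₂²) = 0`
(`TwoCopyIMS.ennnorm_sq_ims`, `TwoCopyIMS.mul_fderiv_add_mul_fderiv_eq_zero`). Summing over the `3(n+1)`
directions of one copy (`TwoCopyIMS.kineticDensity_ims`) and then over both copies (slices of `C¹` functions are
differentiable), `kinetic2 (Θ J₁) + kinetic2 (Θ J₂) = kinetic2 Θ + |Θ|² (kinetic2 J₁ + kinetic2 J₂)` pointwise, while
the potential terms add up since `|Θ J₁|² + |Θ J₂|² = |Θ|²`; integrating (`lintegral_add_left`, the two-copy energy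
density of a continuous function being jointly measurable, `HalfSwapForm.measurable_integrand`) gives the IMS
localisation formula `E2(0)(Θ J₁) + E2(0)(Θ J₂) = E2(0)(Θ) + ∫ |Θ|² (|∇J₁|² + |∇J₂|²)` (`TwoCopyIMS.E2zero_ims`).
(2) FLOOR: `Θ J₂` is `C¹` and periodic in both copies, so the two slice floors
`ProductLower.periodicGroundStateEnergy_mul_le_lintegral_sliceLeft/Right` ('bosonic infimum = absolute infimum',
slice by slice, Tonelli) add up to `2 E₀^per · ‖Θ J₂‖² ≤ E2(0)(Θ J₂)` (`TwoCopyIMS.floor`). (3) Add. Everything is in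
`ℝ≥0∞` (`⊤` allowed, no subtraction). Source of the localisation formula: H. L. Cycon, R. G. Froese, W. Kirsch,
B. Simon, *Schrödinger Operators* (Springer 1987), Thm. 3.2 (Ismagilov–Morgan–Simon / Sigal); standard, tagged
folklore (cf. `Literature/…/BoseGasSlabLocalization.lean`, the one-copy slab version).
-/

noncomputable section

open MeasureTheory Filter
open scoped ENNReal NNReal BigOperators ComplexConjugate

namespace Summit.AtomisticToContinuum.BoseEinsteinCondensation.Cruxes.TorusHalfSwapOverlap.Birth

open Literature.MathematicalPhysics.QuantumManyBody.BoseGas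

/-! ### Helper lemmas (inside `namespace TwoCopyIMS … end TwoCopyIMS`) -/

namespace TwoCopyIMS

variable {M : ℕ}

/-! #### Pointwise algebra of the IMS cross terms -/

/-- The IMS algebra for one direction: for complex `a, w` and real `α, β, γ, δ` with `α² + γ² = 1` and
`α β + γ δ = 0`, `|w β + α a|² + |w δ + γ a|² = |a|² + |w|² (β² + δ²)` (the cross terms cancel), in `ℝ≥0∞`
with the real derivatives read in `ℂ`. [folklore] -/
theorem ennnorm_sq_ims (a w : ℂ) {α β γ δ : ℝ} (hsq : α ^ 2 + γ ^ 2 = 1) (horth : α * β + γ * δ = 0) :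
    ((‖w * (β : ℂ) + (α : ℂ) * a‖₊ : ℝ≥0∞)) ^ 2 + ((‖w * (δ : ℂ) + (γ : ℂ) * a‖₊ : ℝ≥0∞)) ^ 2 =
      ((‖a‖₊ : ℝ≥0∞)) ^ 2 +
        ((‖w‖₊ : ℝ≥0∞)) ^ 2 * (((‖(β : ℂ)‖₊ : ℝ≥0∞)) ^ 2 + ((‖(δ : ℂ)‖₊ : ℝ≥0∞)) ^ 2) := by
  have key : ‖w * (β : ℂ) + (α : ℂ) * a‖ ^ 2 + ‖w * (δ : ℂ) + (γ : ℂ) * a‖ ^ 2 =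
      ‖a‖ ^ 2 + ‖w‖ ^ 2 * (‖(β : ℂ)‖ ^ 2 + ‖(δ : ℂ)‖ ^ 2) := by
    simp only [Complex.sq_norm, Complex.normSq_apply, Complex.add_re, Complex.add_im, Complex.mul_re,
      Complex.mul_im, Complex.ofReal_re, Complex.ofReal_im]
    linear_combination (a.re * a.re + a.im * a.im) * hsq + 2 * (w.re * a.re + w.im * a.im) * horth
  have keyNN : ‖w * (β : ℂ) + (α : ℂ) * a‖₊ ^ 2 + ‖w * (δ : ℂ) + (γ : ℂ) * a‖₊ ^ 2 =
      ‖a‖₊ ^ 2 + ‖w‖₊ ^ 2 * (‖(β : ℂ)‖₊ ^ 2 + ‖(δ : ℂ)‖₊ ^ 2) :=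
    NNReal.coe_injective (by push_cast; exact key)
  exact_mod_cast congrArg ((↑) : ℝ≥0 → ℝ≥0∞) keyNN

/-- The masses of a quadratic partition add up: `|w α|² + |w γ|² = |w|²` for `α² + γ² = 1`, in `ℝ≥0∞`.
[folklore] -/
theorem ennnorm_sq_mul_add (w : ℂ) {α γ : ℝ} (hsq : α ^ 2 + γ ^ 2 = 1) :
    ((‖w * (α : ℂ)‖₊ : ℝ≥0∞)) ^ 2 + ((‖w * (γ : ℂ)‖₊ : ℝ≥0∞)) ^ 2 = ((‖w‖₊ : ℝ≥0∞)) ^ 2 := by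
  have key : ‖w * (α : ℂ)‖ ^ 2 + ‖w * (γ : ℂ)‖ ^ 2 = ‖w‖ ^ 2 := by
    rw [norm_mul, norm_mul, Complex.norm_real, Complex.norm_real, Real.norm_eq_abs, Real.norm_eq_abs,
      mul_pow, mul_pow, sq_abs, sq_abs]
    linear_combination ‖w‖ ^ 2 * hsq
  have keyNN : ‖w * (α : ℂ)‖₊ ^ 2 + ‖w * (γ : ℂ)‖₊ ^ 2 = ‖w‖₊ ^ 2 :=
    NNReal.coe_injective (by push_cast; exact key)
  exact_mod_cast congrArg ((↑) : ℝ≥0 → ℝ≥0∞) keyNN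

/-- Differentiating a quadratic partition of unity: if `j₁² + j₂² = 1` everywhere and `j₁, j₂` are
differentiable at `x`, then `j₁ ∂_d j₁ + j₂ ∂_d j₂ = 0` at `x` in every direction `d`. [folklore] -/
theorem mul_fderiv_add_mul_fderiv_eq_zero {E : Type*} [NormedAddCommGroup E] [NormedSpace ℝ E]
    {j₁ j₂ : E → ℝ} {x : E} (h₁ : DifferentiableAt ℝ j₁ x) (h₂ : DifferentiableAt ℝ j₂ x)
    (hJ : ∀ y, j₁ y ^ 2 + j₂ y ^ 2 = 1) (d : E) :
    j₁ x * fderiv ℝ j₁ x d + j₂ x * fderiv ℝ j₂ x d = 0 := by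
  have hD := (h₁.hasFDerivAt.fun_mul h₁.hasFDerivAt).fun_add (h₂.hasFDerivAt.fun_mul h₂.hasFDerivAt)
  have hc : (fun y => j₁ y * j₁ y + j₂ y * j₂ y) = fun _ => (1 : ℝ) :=
    funext fun y => by rw [← hJ y]; ring
  have h0 : HasFDerivAt (fun y => j₁ y * j₁ y + j₂ y * j₂ y) (0 : E →L[ℝ] ℝ) x := by
    rw [hc]
    exact hasFDerivAt_const 1 x
  have h := congrArg (fun T : E →L[ℝ] ℝ => T d) (hD.unique h0)
  simp only [_root_.add_apply, _root_.smul_apply, smul_eq_mul, _root_.zero_apply] at h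
  linarith

/-! #### The pointwise IMS identity for the kinetic density of one copy -/

/-- **Pointwise IMS localisation formula** (one copy): for `φ : (ℝ³)^M → ℂ` and real `j₁, j₂`
differentiable at `X` with `j₁² + j₂² = 1`,
`|∇(φ j₁)|²(X) + |∇(φ j₂)|²(X) = |∇φ|²(X) + |φ X|² (|∇j₁|²(X) + |∇j₂|²(X))`
(the kinetic densities of the real `j`'s read in `ℂ`). [folklore] -/
theorem kineticDensity_ims {φ : Config M → ℂ} {j₁ j₂ : Config M → ℝ} {X : Config M}
    (hφ : DifferentiableAt ℝ φ X) (h₁ : DifferentiableAt ℝ j₁ X) (h₂ : DifferentiableAt ℝ j₂ X)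
    (hJ : ∀ Y, j₁ Y ^ 2 + j₂ Y ^ 2 = 1) :
    kineticDensity (fun Y => φ Y * (j₁ Y : ℂ)) X + kineticDensity (fun Y => φ Y * (j₂ Y : ℂ)) X =
      kineticDensity φ X + ((‖φ X‖₊ : ℝ≥0∞)) ^ 2 *
        (kineticDensity (fun Y => (j₁ Y : ℂ)) X + kineticDensity (fun Y => (j₂ Y : ℂ)) X) := by
  -- the complexified multipliers and the product rule
  have h₁c : HasFDerivAt (fun Y => (j₁ Y : ℂ)) (Complex.ofRealCLM.comp (fderiv ℝ j₁ X)) X :=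
    Complex.ofRealCLM.hasFDerivAt.comp X h₁.hasFDerivAt
  have h₂c : HasFDerivAt (fun Y => (j₂ Y : ℂ)) (Complex.ofRealCLM.comp (fderiv ℝ j₂ X)) X :=
    Complex.ofRealCLM.hasFDerivAt.comp X h₂.hasFDerivAt
  have hp₁ := (hφ.hasFDerivAt.fun_mul h₁c).fderiv
  have hp₂ := (hφ.hasFDerivAt.fun_mul h₂c).fderiv
  unfold kineticDensity
  simp only [mul_add, Finset.mul_sum, ← Finset.sum_add_distrib]
  refine Finset.sum_congr rfl fun i _ => Finset.sum_congr rfl fun k _ => ?_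
  rw [← mul_add, hp₁, hp₂, h₁c.fderiv, h₂c.fderiv]
  simp only [_root_.add_apply, _root_.smul_apply, smul_eq_mul, ContinuousLinearMap.coe_comp,
    Function.comp_apply, Complex.ofRealCLM_apply]
  exact ennnorm_sq_ims _ _ (hJ X) (mul_fderiv_add_mul_fderiv_eq_zero h₁ h₂ hJ _)

/-! #### Two copies: slices, the pointwise identity for `kinetic2`, the integrated identity -/

/-- The `X`-slice of a `C¹` function of two copies is differentiable. [folklore] -/
theorem differentiableAt_sliceFst {F : Type*} [NormedAddCommGroup F] [NormedSpace ℝ F]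
    {f : Config M × Config M → F} (hf : ContDiff ℝ 1 f) (Z : Config M × Config M) :
    DifferentiableAt ℝ (fun X => f (X, Z.2)) Z.1 :=
  ((hf.comp (contDiff_prodMk_left Z.2)).differentiable one_ne_zero) Z.1

/-- The `Y`-slice of a `C¹` function of two copies is differentiable. [folklore] -/
theorem differentiableAt_sliceSnd {F : Type*} [NormedAddCommGroup F] [NormedSpace ℝ F]
    {f : Config M × Config M → F} (hf : ContDiff ℝ 1 f) (Z : Config M × Config M) :
    DifferentiableAt ℝ (fun Y => f (Z.1, Y)) Z.2 :=
  ((hf.comp (contDiff_prodMk_right Z.1)).differentiable one_ne_zero) Z.2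

/-- Bookkeeping: the two one-copy identities assemble to the two-copy one. [folklore] -/
private theorem comb_kinetic {a₁ a₂ b₁ b₂ a b m x₁ x₂ y₁ y₂ : ℝ≥0∞}
    (h1 : a₁ + a₂ = a + m * (x₁ + x₂)) (h2 : b₁ + b₂ = b + m * (y₁ + y₂)) :
    a₁ + b₁ + (a₂ + b₂) = a + b + m * (x₁ + y₁ + (x₂ + y₂)) := by
  calc a₁ + b₁ + (a₂ + b₂) = (a₁ + a₂) + (b₁ + b₂) := add_add_add_comm _ _ _ _
    _ = _ := by rw [h1, h2]; ring

/-- **Pointwise two-copy IMS identity**: for `C¹` `Θ` (complex) and `J₁, J₂` (real) with `J₁² + J₂² = 1`,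
`kinetic2 (Θ J₁) Z + kinetic2 (Θ J₂) Z = kinetic2 Θ Z + |Θ Z|² (kinetic2 J₁ Z + kinetic2 J₂ Z)`. [folklore] -/
theorem kinetic2_ims {n : ℕ} {Θ : Config (n + 1) × Config (n + 1) → ℂ}
    {J₁ J₂ : Config (n + 1) × Config (n + 1) → ℝ} (hΘ : ContDiff ℝ 1 Θ) (hJ₁ : ContDiff ℝ 1 J₁)
    (hJ₂ : ContDiff ℝ 1 J₂) (hJ : ∀ Z, J₁ Z ^ 2 + J₂ Z ^ 2 = 1) (Z : Config (n + 1) × Config (n + 1)) :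
    TwoCopyTorus.kinetic2 n (fun Z => Θ Z * (J₁ Z : ℂ)) Z + TwoCopyTorus.kinetic2 n (fun Z => Θ Z * (J₂ Z : ℂ)) Z =
      TwoCopyTorus.kinetic2 n Θ Z + ((‖Θ Z‖₊ : ℝ≥0∞)) ^ 2 *
        (TwoCopyTorus.kinetic2 n (fun W => (J₁ W : ℂ)) Z + TwoCopyTorus.kinetic2 n (fun W => (J₂ W : ℂ)) Z) := by
  have hX := kineticDensity_ims (φ := fun X => Θ (X, Z.2)) (j₁ := fun X => J₁ (X, Z.2))
    (j₂ := fun X => J₂ (X, Z.2)) (differentiableAt_sliceFst hΘ Z) (differentiableAt_sliceFst hJ₁ Z)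
    (differentiableAt_sliceFst hJ₂ Z) (fun X => hJ (X, Z.2))
  have hY := kineticDensity_ims (φ := fun Y => Θ (Z.1, Y)) (j₁ := fun Y => J₁ (Z.1, Y))
    (j₂ := fun Y => J₂ (Z.1, Y)) (differentiableAt_sliceSnd hΘ Z) (differentiableAt_sliceSnd hJ₁ Z)
    (differentiableAt_sliceSnd hJ₂ Z) (fun Y => hJ (Z.1, Y))
  simp only [Prod.mk.eta] at hX hY
  simp only [TwoCopyTorus.kinetic2]
  exact comb_kinetic hX hY

/-- The uncoupled two-copy energy density `kinetic2 f + (V(X) + V(Y)) |f|²` of a continuous `f` is jointly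
measurable (for a measurable profile `v`). [folklore] -/
theorem measurable_density {v : ℝ → ℝ≥0∞} (hv : Measurable v) (n : ℕ) (L : ℝ)
    {f : Config (n + 1) × Config (n + 1) → ℂ} (hf : Continuous f) :
    Measurable fun Z : Config (n + 1) × Config (n + 1) =>
      TwoCopyTorus.kinetic2 n f Z +
        (periodicInteraction v L Z.1 + periodicInteraction v L Z.2) * ((‖f Z‖₊ : ℝ≥0∞)) ^ 2 :=
  HalfSwapForm.measurable_integrand
    (((measurable_periodicInteraction hv L).comp measurable_fst).add
      ((measurable_periodicInteraction hv L).comp measurable_snd)) hf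

/-- Bookkeeping: kinetic identity and mass identity assemble to the identity of the densities. [folklore] -/
private theorem comb_density {k₁ k₂ k m₁ m₂ m W S : ℝ≥0∞} (hk : k₁ + k₂ = k + m * S) (hm : m₁ + m₂ = m) :
    k₁ + W * m₁ + (k₂ + W * m₂) = k + W * m + m * S := by
  calc k₁ + W * m₁ + (k₂ + W * m₂) = (k₁ + k₂) + W * (m₁ + m₂) := by ring
    _ = _ := by rw [hk, hm, add_right_comm]

/-- **The two-copy IMS localisation formula**: for `C¹` `Θ` and a `C¹` real quadratic partition of unity
`J₁² + J₂² = 1`, `E2(0)(Θ J₁) + E2(0)(Θ J₂) = E2(0)(Θ) + ∫_{cell²} |Θ|² (|∇J₁|² + |∇J₂|²)`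
(Cycon–Froese–Kirsch–Simon 1987, Thm. 3.2, two-copy torus form). [folklore] -/
theorem E2zero_ims {v : ℝ → ℝ≥0∞} (hv : Measurable v) {n : ℕ} (L : ℝ)
    {Θ : Config (n + 1) × Config (n + 1) → ℂ} {J₁ J₂ : Config (n + 1) × Config (n + 1) → ℝ}
    (hΘ : ContDiff ℝ 1 Θ) (hJ₁ : ContDiff ℝ 1 J₁) (hJ₂ : ContDiff ℝ 1 J₂) (hJ : ∀ Z, J₁ Z ^ 2 + J₂ Z ^ 2 = 1) :
    TwoCopyTorus.E2zero v n L (fun Z => Θ Z * (J₁ Z : ℂ)) + TwoCopyTorus.E2zero v n L (fun Z => Θ Z * (J₂ Z : ℂ)) =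
      TwoCopyTorus.E2zero v n L Θ +
        ∫⁻ Z in TwoCopyTorus.cell2 n L, ((‖Θ Z‖₊ : ℝ≥0∞)) ^ 2 *
          (TwoCopyTorus.kinetic2 n (fun W => (J₁ W : ℂ)) Z + TwoCopyTorus.kinetic2 n (fun W => (J₂ W : ℂ)) Z) := by
  have hC₁ : ContDiff ℝ 1 fun Z => Θ Z * (J₁ Z : ℂ) := hΘ.mul (Complex.ofRealCLM.contDiff.comp hJ₁)
  simp only [TwoCopyTorus.E2zero]
  rw [← lintegral_add_left (measurable_density hv n L hC₁.continuous),
    ← lintegral_add_left (measurable_density hv n L hΘ.continuous)]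
  exact lintegral_congr fun Z => comb_density (kinetic2_ims hΘ hJ₁ hJ₂ hJ Z) (ennnorm_sq_mul_add (Θ Z) (hJ Z))

/-! #### The mass-weighted bosonic floor on both copies -/

/-- **Two-copy bosonic floor**: for a `C¹` two-copy function `Φ` periodic in every particle of either copy,
`2 E₀^per(n+1, L) · ∫_{cell²} |Φ|² ≤ E2(0)(Φ)` (the two slice floors of `ProductLower`, added). [folklore] -/
theorem floor {v : ℝ → ℝ≥0∞} (hv : Measurable v) (n : ℕ) (L : ℝ)
    {Φ : Config (n + 1) × Config (n + 1) → ℂ} (hΦ : ContDiff ℝ 1 Φ) (hper : TwoCopyTorus.IsPeriodic2 n L Φ) :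
    2 * periodicGroundStateEnergy v (n + 1) L *
        ∫⁻ Z in TwoCopyTorus.cell2 n L, ((‖Φ Z‖₊ : ℝ≥0∞)) ^ 2 ≤ TwoCopyTorus.E2zero v n L Φ := by
  have h1 := ProductLower.periodicGroundStateEnergy_mul_le_lintegral_sliceLeft hv hΦ fun Z i k => (hper Z i k).1
  have h2 := ProductLower.periodicGroundStateEnergy_mul_le_lintegral_sliceRight hv hΦ fun Z i k => (hper Z i k).2
  unfold TwoCopyTorus.E2zero TwoCopyTorus.cell2
  refine (le_of_eq ?_).trans ((add_le_add h1 h2).trans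
    ((le_lintegral_add _ _).trans (le_of_eq (lintegral_congr fun Z => ?_))))
  · ring
  · simp only [TwoCopyTorus.kinetic2]
    ring

end TwoCopyIMS

/-! ### The registered stub -/

/-- S7i — **two-copy IMS localisation with the bosonic floor**: for every repulsive finite-range `v`, every
`n`, `L`, every `C¹` two-copy function `Θ` periodic in both copies and every `C¹` periodic real quadratic
partition of unity `J₁² + J₂² = 1`,
`E2(0)(Θ J₁) + 2 E₀^per(n+1, L) · ‖Θ J₂‖² ≤ E2(0)(Θ) + ∫_{cell²} |Θ|² (|∇J₁|² + |∇J₂|²)`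
(`stub_twoCopyIMS`, registered signature). [folklore] -/
theorem stub_twoCopyIMS :
    ∀ v : ℝ → ℝ≥0∞, IsRepulsiveFiniteRange v → ∀ (n : ℕ) (L : ℝ) (Θ : Config (n + 1) × Config (n + 1) → ℂ)
      (J₁ J₂ : Config (n + 1) × Config (n + 1) → ℝ),
      ContDiff ℝ 1 Θ → TwoCopyTorus.IsPeriodic2 n L Θ → ContDiff ℝ 1 J₁ → ContDiff ℝ 1 J₂ →
      TwoCopyTorus.IsPeriodic2 n L (fun Z => (J₁ Z : ℂ)) → TwoCopyTorus.IsPeriodic2 n L (fun Z => (J₂ Z : ℂ)) →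
      (∀ Z, J₁ Z ^ 2 + J₂ Z ^ 2 = 1) →
      TwoCopyTorus.E2zero v n L (fun Z => Θ Z * (J₁ Z : ℂ)) +
          2 * periodicGroundStateEnergy v (n + 1) L *
            ∫⁻ Z in TwoCopyTorus.cell2 n L, (‖Θ Z * (J₂ Z : ℂ)‖₊ : ℝ≥0∞) ^ 2 ≤
        TwoCopyTorus.E2zero v n L Θ +
          ∫⁻ Z in TwoCopyTorus.cell2 n L, (‖Θ Z‖₊ : ℝ≥0∞) ^ 2 *
            (TwoCopyTorus.kinetic2 n (fun W => (J₁ W : ℂ)) Z + TwoCopyTorus.kinetic2 n (fun W => (J₂ W : ℂ)) Z) := by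
  intro v hv n L Θ J₁ J₂ hΘ hperΘ hJ₁ hJ₂ _ hperJ₂ hJ
  -- `Θ J₂` is `C¹` and periodic in both copies, hence obeys the two-copy bosonic floor
  have hC₂ : ContDiff ℝ 1 fun Z => Θ Z * (J₂ Z : ℂ) := hΘ.mul (Complex.ofRealCLM.contDiff.comp hJ₂)
  have hper₂ : TwoCopyTorus.IsPeriodic2 n L (fun Z => Θ Z * (J₂ Z : ℂ)) := by
    intro Z i k
    obtain ⟨hΘ1, hΘ2⟩ := hperΘ Z i k
    obtain ⟨hJ1, hJ2⟩ := hperJ₂ Z i k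
    dsimp only at hJ1 hJ2 ⊢
    rw [hΘ1, hJ1, hΘ2, hJ2]
    exact ⟨rfl, rfl⟩
  exact (add_le_add le_rfl (TwoCopyIMS.floor hv.1 n L hC₂ hper₂)).trans
    (TwoCopyIMS.E2zero_ims hv.1 L hΘ hJ₁ hJ₂ hJ).le

end Summit.AtomisticToContinuum.BoseEinsteinCondensation.Cruxes.TorusHalfSwapOverlap.Birth

end
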